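import Literature.MathematicalPhysics.QuantumFieldTheory.Balaban1983to89.B11Eq117MiddleWordPiTransformationNorm
import Literature.MathematicalPhysics.QuantumFieldTheory.Balaban1983to89.B11Eq117GtildeTransformationNorm
import Literature.MathematicalPhysics.QuantumFieldTheory.Balaban1983to89.B9Eq347FrakGkPiSupGlobal

/-!
# `Balaban1983to89.B11Eq117FrakGkPiTransformationNorm` — T. Bałaban, *The variational problem and background fields in renormalization group method for lattice
# gauge theories*, Commun. Math. Phys. **102** (1985) 277–309 [Balaban1985Variational] (117) p. 295 *«By Theorem 3.13 of [5] the norm max{|·|_{(−1)}, |∇·|_{(−2)}} of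
# the transformation can be estimated by B₀|J|_{(−3)} + …»*, (110)–(111) p. 294 (*«𝔊 = G − GQ\*(QGQ\*)⁻¹QG − GDRD\*G»*), with [5] = [Balaban1985BackgroundPropagators]
# Thm 3.13 p. 426, (3.153) p. 426, Thm 3.1 (3.42)∕(3.44)∕(3.47) pp. 397–398: **THE (117) SOCKET FOR THE FULL `𝔊̃_k` — `‖toCLM115 ∇_U 𝔊̃_k‖ ≤ max(w̄₀·B, w̄₁·B)·w̲⁻¹` with ONE
# height-free `B` — MODULO EXACTLY ONE DISPLAYED LETTER: the local covariant-gradient row of the THIRD word `G̃_kD_UR_kD*_UG̃_k` (STOREY H of the NE9 owner's ruling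
# R-ne9p1-g97-3; by this lineage's G-1 `B9Eq3152GtildeThirdWordTwoSided` = `∇_UD_UG′_kR_kG′_kD*_U`, print's Thm 3.1 (3.43)₂∕(3.44) for `G′_k`)** — everything else BY
# NAME: the global value letter of `𝔊̃_k` (ne9-leaf-05's (K86) `B9Eq347FrakGkPiSupGlobal`), the gradient letters of the first word (the owner's (T4C)
# `B9Eq347G1kPiSupGradGlobal`) and of the middle word (this lineage's J-3 `B9Eq347MiddleWordPiSupGradGlobal`), the socket (the owner's `B11Eq117TransformationNormComp`)

statement-level skeleton of published theorems with citation tags; proofs where landed; nothing here is a claim about the Yang–Mills mass gap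

CITATION HEADER (lean-in-tree rule).  Audit cell `pub-balaban`, sub-cell `t4`, BINDER row NE9; filed by NE9 crux-team LEAF PROVER 01 (`b2b-balaban-t4-ne9-formalise-leaf-01`,
gen 92; bears_on: R4/N22).  PDF held: `paper:balaban1985-cmp102-variational-background` (journal page = PDF page + 276), p. 295 (117) read through the verbatim quotation of
`B11Eq117TransformationNorm`; [5] pp. 397–398, 425–426 read first-hand this generation (`paper:balaban1985-cmp99-background-propagators` PDF 9–11, 37–38).  COMPOSED BY
NAME: `B11Eq103H1Complex.frakGLatticeK` ∕ `B11Eq111FrakG.frakGLin_apply` ∕ `H1LatticeK_eq` (the three words), (K86) `exists_global_row_frakGLatticeKPi`, (T4C)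
`exists_global_rows_G1kPi` (conjunct 3, the slice-gradient member), J-3 `exists_global_supGrad_H1kPiQkG1kPi` (conjunct 2), ne9-leaf-03's (G)
`B9Eq347GlobalFromLocal.norm_apply_le_of_local`, (VGT-a) `norm_covGrad_apply_le_of_slice`, the owner's socket `B11Eq117TransformationNormComp.norm_toCLM115_le_of_comp`
(pattern: the owner's (T4F) `B11Eq117GtildeTransformationNorm` and this lineage's J-4 `B11Eq117MiddleWordPiTransformationNorm`).  The owner's window `‖J‖ ≤ α` of the
(T4C)∕(T4E)-shaped blocks is met from this block's `‖J‖ ≤ j₀` at the enlarged radius `max(α, j₀)` (every window member is monotone in `α` — (K85)'s device).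

WHAT IS PROVED (sorry-free; proof lane — 0 `def`; [folklore] bookkeeping).
* §1 **`exists_global_gradLetter_thirdWord_of_local`** — MODULO the displayed `∃`-first LOCAL slice-gradient letter `H3` of the third word ((T4E)'s binder block +
  `(μ : Fin d)`, base-block decay), its GLOBAL sup → sup letter `‖(D_U(G̃_kD_UR_kD*_UG̃_kf)_μ)(b)‖ ≤ B·M` ((G) `norm_apply_le_of_local`, `K_d(δ)`).
* §2 **`exists_global_supGrad_frakGLatticeKPi_of_thirdWord`** — MODULO `H3`: `∃ (α₁, j₁, B)` BEFORE (K86)'s binder block such that for every bond field `f` with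
  `‖f‖_∞ ≤ M`, every `μ`, `b`: `‖(𝔊̃_kf)(b)‖ ≤ B·M ∧ ‖(D_U(𝔊̃_kf)_μ)(b)‖ ≤ B·M ∧ ‖(∇_U𝔊̃_kf)(b, μ)‖ ≤ B·M` — `𝔊̃_kf = G̃_kf − H̃_k(Q_k(G̃_kf)) − third` and the
  three gradient letters (T4C).3, J-3.2, §1; `B = B_{K86} + B_{T4C} + B_{J3} + B₃K_d(δ₃)`.
* §3 **`exists_norm_toCLM115_frakGkPi_le_of_thirdWord`** — MODULO `H3`: THE (117) SOCKET FOR `𝔊̃_k` READ ON THE PLAIN BOND FUNCTIONS, `‖toCLM115 ∇_U 𝔊̃_k‖ ≤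
  max(w̄₀·B, w̄₁·B)·w̲⁻¹` for ANY level functions ∕ weight parameters of (115).
HONEST SCOPE.  Composition BY NAME; the third word's gradient row is a DISPLAYED HYPOTHESIS of the exact shape the successor junction file
(`B9Eq3152ThirdWordPiGradRowOfHolderLetters`, G-2 of this generation's INTENT) concludes from print's Thm 3.1 (3.43)₂∕(3.44) for `G′_k(U)` — themselves NOT in the
tree on the cell's MODEL (flat (3.43) kernel-checked on lit-balaban's torus-lineage carrier only); `hpos′`, `hpos`, `hposπ`, `hQ`, the windows, `c₀ = η^d`, `‖J‖ ≤ j₀`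
stay DISPLAYED; constants crude, NOT print's `B₀`; nothing of [B9] Thm 3.1∕3.13 or [B11] (110)–(111)∕(117) is asserted, valued or discharged; «NE9 ⇐ the named binders»;
NE9 NOT PRINTED ∕ NOT PROVED; row WALLED ON A MODEL (O-NE9-1; #5 UNRULED); spine PROVED 0∕9; rung (B)+1 on a finite T⁴ — NOT infinite volume, NOT mass gap, NOT BetaPertH,
NOT Clay.  HONEST DEPENDENCY: continuum YM on T⁴ ⇐ BetaPertH ∧ nine spine estimates (0/9 proved); BetaPertH ⇐ (D1) ∧ (D4) ∧ CAP+tail; G-an2-4 gates asym, D1 and NE2/3/4.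
NEW file importing BUILT modules (J-4, (T4F), (K86)); nothing modified.  Net new unproved facts: 0.
-/

noncomputable section

set_option autoImplicit false

open scoped InnerProductSpace ComplexConjugate BigOperators

namespace Literature.MathematicalPhysics.QuantumFieldTheory.Balaban1983to89.B11Eq117FrakGkPiTransformationNorm

open B4Sect5Torus (TSite tdist tdist_nonneg torusSum_le)
open B4Sect5Proof (latticeConst latticeConst_nonneg)
open B9SectCLatticeCarrier (Bond bpos btgt unshift)
open B9Eq311L2Pairing (WL2)
open B9Eq33CovDerivVector (covGrad)
open B9Eq319QprimeTorus (fineP blockCoord)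
open B7Prop1Explicit (U1 Wcx boxVec)
open B11Eq103H1Complex (SiteL2K BondL2K covDerivL2K covDivL2K G1LatticeK H1LatticeK H1LatticeK_eq frakGLatticeK)
open B9Eq310DeltaPrime (plaqHolU)
open B9Eq310HessianOperator (adTransportW)
open B9Eq315QTorus (perCfg cornerSite)
open B9Eq315QTower (towerP UlevOf)
open B9Eq316TowerFlatIsOneStep (towerP_eq_fineP_pow siteCast)
open B9Eq326OperatorTower (QkW RofUk laplaceAk)
open B9Eq3119DeltaPiTower (laplaceAkPi)
open B9Eq324DeltaPrimeATower (laplacePrimeAk)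
open B11Eq115Space (NegSup levWeight)
open B11Eq111FrakG (toCLM115 frakGLin_apply)
open B11Eq117TransformationNormComp (norm_toCLM115_le_of_comp)
open B9Eq347G1kPiSupGradGlobal (exists_global_rows_G1kPi)
open B9Eq347MiddleWordPiSupGradGlobal (exists_global_supGrad_H1kPiQkG1kPi)
open B9Eq347FrakGkPiSupGlobal (exists_global_row_frakGLatticeKPi)
open B9Eq347GlobalFromLocal (norm_apply_le_of_local)
open B9Eq326LocalPartTowerSliceGradientRow (norm_covGrad_apply_le_of_slice)

variable {d : ℕ} (hd : 1 ≤ d) (L : ℕ) [NeZero L] (hL : 1 ≤ L) (hL3 : 3 ≤ L)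
  {𝔸 : Type*} [NormedRing 𝔸] [NormedAlgebra ℂ 𝔸] [CompleteSpace 𝔸] [NormOneClass 𝔸] [StarRing 𝔸] [NormedStarGroup 𝔸] [StarModule ℂ 𝔸]
  {W : Type*} [NormedAddCommGroup W] [InnerProductSpace ℂ W] [FiniteDimensional ℂ W] (φ : W ≃ₗ[ℂ] 𝔸)
  {Mφ Mφ' : ℝ} (hMφ : 0 ≤ Mφ) (hMφ' : 0 ≤ Mφ') (hφ : ∀ w, ‖φ w‖ ≤ Mφ * ‖w‖) (hφ' : ∀ X, ‖φ.symm X‖ ≤ Mφ' * ‖X‖) (hstar : ∀ X : 𝔸, ‖star X‖ ≤ ‖X‖)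
  {a : ℝ} (ha : 0 < a) {a' : ℝ} (ha' : 0 < a') {ϱ : ℝ} (hϱ0 : 0 ≤ ϱ) (hϱ1 : ϱ < 1)
  (τ : 𝔸 →ₗ[ℂ] ℂ) {Cτ : ℝ} (hτ : ∀ X, ‖τ X‖ ≤ Cτ * ‖X‖) (hCτ : 0 ≤ Cτ) {Mτ : ℝ} (hτm : ∀ X Y : 𝔸, ‖τ (X * Y)‖ ≤ Mτ * ‖X‖ * ‖Y‖) (hMτ : 0 ≤ Mτ)
  {ρw : ℝ} (hρw : 0 ≤ ρw)
  (hτ₁ : ∀ X : 𝔸, τ (star X) = conj (τ X)) (hτ₂ : ∀ X Y : 𝔸, τ (X * Y) = τ (Y * X)) (hφτ : ∀ X Y : 𝔸, ⟪φ.symm X, φ.symm Y⟫_ℂ = τ (star X * Y))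
  (AQ : ℝ)

/-! ## §0 The displayed letter: the local slice-gradient row of the third word (STOREY H) -/

/-! THE ONE DISPLAYED LETTER `H3` (a hypothesis SHAPE written out in §1–§3, not a definition of the tree): the local slice-gradient row of the third word
`G̃_kD_UR_kD*_UG̃_k` of `𝔊̃_k` on (T4E)'s binder block — `∃ (α₃, B₃, δ₃)` first; for `f` supported over `Π⁻¹(v)` with `‖f‖_∞ ≤ F`, every `μ` and bond `b`:
`‖(D_U(G̃_kD_UR_kD*_UG̃_kf)_μ)(b)‖ ≤ B₃·e^{−δ₃·d_m(Π(b₋),v)}·F`.  By G-1 the word is `D_UG′_kR_kG′_kD*_U`; the letter is Thm 3.13's gradient row for this word, to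
be supplied from Thm 3.1 (3.43)₂∕(3.44) for `G′_k` (successor junction file); a supplier's theorem of this literal type discharges it. -/

set_option maxHeartbeats 400000 in -- the ≈ 50-binder hypothesis shape + one summation: margin as the siblings (T4C)∕J-3
omit [NormedStarGroup 𝔸] in
include hL in
/-- **§1 THE GLOBAL sup → sup GRADIENT LETTER OF THE THIRD WORD, MODULO ITS LOCAL ROW `H3`** — one summation over the source blocks ((G) `norm_apply_le_of_local`,
row constant `K_d(δ₃)`). [folklore] [cite: Balaban1985BackgroundPropagators, Thm 3.1 (3.47) p.398, Thm 3.13 p.426; Balaban1984PropagatorsII, Lemma 2.1 (2.61) p.234] -/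
theorem exists_global_gradLetter_thirdWord_of_local
    (H3 : ∃ α₃ B₃ δ₃ : ℝ, 0 < α₃ ∧ 0 ≤ B₃ ∧ 0 < δ₃ ∧
      ∀ (n : ℕ) (η : ℝ) (_hηL : η * (L : ℝ) ^ (n + 1) = 1) (c₀ c₁ : ℝ) [Fact (0 < c₀)] [Fact (0 < c₁)]
        (_hw : c₀ * ((L : ℝ) ^ (n + 1)) ^ d = c₁) (_hρ : |η| ^ d / c₀ ≤ ρw) (m : Fin d → ℕ) [∀ i, NeZero (m i)] (_hm : ∀ i, 1 ≤ m i)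
        (U : Bond d (towerP L m (n + 1)) → 𝔸ˣ) (αU : ℕ → ℝ) (_hα0 : ∀ j, 0 ≤ αU j) (hα1 : ∀ j, αU j ≤ 1 / 64)
        (hU1 : ∀ (j : ℕ) (x : B7Prop1Explicit.Site d) (k : Fin d), perCfg (towerP L m (j + 1)) (UlevOf L m (n + 1) U j) x k ∈ U1 𝔸)
        (hreg : ∀ (j : ℕ) (y : TSite d (towerP L m j)) (k : Fin d) (ρ' : Fin d → Fin L),
          ‖((Wcx L (perCfg (towerP L m (j + 1)) (UlevOf L m (n + 1) U j)) (cornerSite L y) k (boxVec L ρ') : 𝔸ˣ) : 𝔸) - 1‖ ≤ αU j)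
        (εU : ℕ → ℝ) (_hεU : ∀ j, 0 ≤ εU j) (_hUε : ∀ (j : ℕ) (b : Bond d (towerP L m (j + 1))), ‖(UlevOf L m (n + 1) U j b : 𝔸) - 1‖ ≤ εU j)
        (_hLb : ∀ (j : ℕ) (b : Bond d (towerP L m (j + 1))), UlevOf L m (n + 1) U j b ∈ U1 𝔸)
        (α : ℝ) (_hα : 0 ≤ α) (_hαle : α ≤ α₃)
        (hUst : ∀ b, star (U b : 𝔸) = (((U b)⁻¹ : 𝔸ˣ) : 𝔸)) (_hUb : ∀ b, U b ∈ U1 𝔸) (_hUη : ∀ b, ‖(U b : 𝔸) - 1‖ ≤ α * η)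
        (_hpl : ∀ p : B9SectCLatticeCarrier.Plaq d (towerP L m (n + 1)), ‖(plaqHolU U p : 𝔸) - 1‖ ≤ α * η ^ 2)
        (_hUgrad : ∀ (x : TSite d (towerP L m (n + 1))) (μ : Fin d), ‖(U (x, μ) : 𝔸) - U (unshift μ x, μ)‖ ≤ α * η ^ 2)
        (_hRlev : ∀ (j : ℕ) (b : Bond d (towerP L m (j + 1))) (w : W), ‖adTransportW φ (UlevOf L m (n + 1) U j) b w‖ ≤ ‖w‖)
        (_hεg : ∀ j < n + 1, εU j ≤ α * ϱ ^ j) (_hAQ : ∑ j ∈ Finset.range (n + 1), αU j ≤ AQ)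
        (hpos' : ∀ x : SiteL2K ℂ d (towerP L m (n + 1)) c₀ W, x ≠ 0 → 0 < RCLike.re ⟪x, laplacePrimeAk L m n φ η U a' (c₁ := c₁) x⟫_ℂ)
        (hpos : ∀ x : BondL2K ℂ d (towerP L m (n + 1)) c₀ W, x ≠ 0 →
          0 < RCLike.re ⟪x, laplaceAk L m n φ η U hL αU hα1 hU1 hreg τ (c₀ := c₀) (c₁ := c₁) a x⟫_ℂ)
        (hposπ : ∀ x : BondL2K ℂ d (towerP L m (n + 1)) c₀ W, x ≠ 0 →
          0 < RCLike.re ⟪x, laplaceAkPi L m n φ τ η U a' hpos' hL αU hα1 hU1 hreg (c₁ := c₁) a x⟫_ℂ)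
        (_hc₀ : c₀ = η ^ d)
        (_hJ : ∀ (μ : Fin d) (y : TSite d (towerP L m (n + 1))),
          ‖B9Eq39Adjoint.J (fun μ => B9Eq33CovDerivVector.shiftEquiv μ) (fun μ y => U (y, μ)) η μ y‖ ≤ α)
        (v : TSite d m) (f : BondL2K ℂ d (towerP L m (n + 1)) c₀ W) (F : ℝ)
        (_hfv : ∀ b, blockCoord (L ^ (n + 1)) m (siteCast (towerP_eq_fineP_pow L m (n + 1)) (bpos b)) ≠ v →
          WL2.equiv ℂ (fun _ : Bond d (towerP L m (n + 1)) => c₀) W f b = 0)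
        (_hfF : ∀ b, ‖WL2.equiv ℂ (fun _ : Bond d (towerP L m (n + 1)) => c₀) W f b‖ ≤ F) (μ : Fin d) (b : Bond d (towerP L m (n + 1))),
        ‖WL2.equiv ℂ (fun _ : Bond d (towerP L m (n + 1)) => c₀) W (covDerivL2K ℂ c₀ ((η : ℂ))⁻¹ (adTransportW φ U)
            ((WL2.equiv ℂ (fun _ : TSite d (towerP L m (n + 1)) => c₀) W).symm fun y =>
              WL2.equiv ℂ (fun _ : Bond d (towerP L m (n + 1)) => c₀) W
                (G1LatticeK hposπ (covDerivL2K ℂ c₀ ((η : ℂ))⁻¹ (adTransportW φ U) (RofUk L m n φ η U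
                  (covDivL2K ℂ c₀ ((η : ℂ))⁻¹ (adTransportW φ fun bb => (U bb)⁻¹) (G1LatticeK hposπ f))))) (y, μ))) b‖ ≤
          B₃ * Real.exp (-(δ₃ * tdist m (blockCoord (L ^ (n + 1)) m (siteCast (towerP_eq_fineP_pow L m (n + 1)) (bpos b))) v)) * F) :
    ∃ α₃ B : ℝ, 0 < α₃ ∧ 0 ≤ B ∧
      ∀ (n : ℕ) (η : ℝ) (_hηL : η * (L : ℝ) ^ (n + 1) = 1) (c₀ c₁ : ℝ) [Fact (0 < c₀)] [Fact (0 < c₁)]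
        (_hw : c₀ * ((L : ℝ) ^ (n + 1)) ^ d = c₁) (_hρ : |η| ^ d / c₀ ≤ ρw) (m : Fin d → ℕ) [∀ i, NeZero (m i)] (_hm : ∀ i, 1 ≤ m i)
        (U : Bond d (towerP L m (n + 1)) → 𝔸ˣ) (αU : ℕ → ℝ) (_hα0 : ∀ j, 0 ≤ αU j) (hα1 : ∀ j, αU j ≤ 1 / 64)
        (hU1 : ∀ (j : ℕ) (x : B7Prop1Explicit.Site d) (k : Fin d), perCfg (towerP L m (j + 1)) (UlevOf L m (n + 1) U j) x k ∈ U1 𝔸)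
        (hreg : ∀ (j : ℕ) (y : TSite d (towerP L m j)) (k : Fin d) (ρ' : Fin d → Fin L),
          ‖((Wcx L (perCfg (towerP L m (j + 1)) (UlevOf L m (n + 1) U j)) (cornerSite L y) k (boxVec L ρ') : 𝔸ˣ) : 𝔸) - 1‖ ≤ αU j)
        (εU : ℕ → ℝ) (_hεU : ∀ j, 0 ≤ εU j) (_hUε : ∀ (j : ℕ) (b : Bond d (towerP L m (j + 1))), ‖(UlevOf L m (n + 1) U j b : 𝔸) - 1‖ ≤ εU j)
        (_hLb : ∀ (j : ℕ) (b : Bond d (towerP L m (j + 1))), UlevOf L m (n + 1) U j b ∈ U1 𝔸)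
        (α : ℝ) (_hα : 0 ≤ α) (_hαle : α ≤ α₃)
        (hUst : ∀ b, star (U b : 𝔸) = (((U b)⁻¹ : 𝔸ˣ) : 𝔸)) (_hUb : ∀ b, U b ∈ U1 𝔸) (_hUη : ∀ b, ‖(U b : 𝔸) - 1‖ ≤ α * η)
        (_hpl : ∀ p : B9SectCLatticeCarrier.Plaq d (towerP L m (n + 1)), ‖(plaqHolU U p : 𝔸) - 1‖ ≤ α * η ^ 2)
        (_hUgrad : ∀ (x : TSite d (towerP L m (n + 1))) (μ : Fin d), ‖(U (x, μ) : 𝔸) - U (unshift μ x, μ)‖ ≤ α * η ^ 2)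
        (_hRlev : ∀ (j : ℕ) (b : Bond d (towerP L m (j + 1))) (w : W), ‖adTransportW φ (UlevOf L m (n + 1) U j) b w‖ ≤ ‖w‖)
        (_hεg : ∀ j < n + 1, εU j ≤ α * ϱ ^ j) (_hAQ : ∑ j ∈ Finset.range (n + 1), αU j ≤ AQ)
        (hpos' : ∀ x : SiteL2K ℂ d (towerP L m (n + 1)) c₀ W, x ≠ 0 → 0 < RCLike.re ⟪x, laplacePrimeAk L m n φ η U a' (c₁ := c₁) x⟫_ℂ)
        (hpos : ∀ x : BondL2K ℂ d (towerP L m (n + 1)) c₀ W, x ≠ 0 →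
          0 < RCLike.re ⟪x, laplaceAk L m n φ η U hL αU hα1 hU1 hreg τ (c₀ := c₀) (c₁ := c₁) a x⟫_ℂ)
        (hposπ : ∀ x : BondL2K ℂ d (towerP L m (n + 1)) c₀ W, x ≠ 0 →
          0 < RCLike.re ⟪x, laplaceAkPi L m n φ τ η U a' hpos' hL αU hα1 hU1 hreg (c₁ := c₁) a x⟫_ℂ)
        (_hc₀ : c₀ = η ^ d)
        (_hJ : ∀ (μ : Fin d) (y : TSite d (towerP L m (n + 1))),
          ‖B9Eq39Adjoint.J (fun μ => B9Eq33CovDerivVector.shiftEquiv μ) (fun μ y => U (y, μ)) η μ y‖ ≤ α)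
        (f : BondL2K ℂ d (towerP L m (n + 1)) c₀ W) (M : ℝ) (_hM : 0 ≤ M)
        (_hfM : ∀ b, ‖WL2.equiv ℂ (fun _ : Bond d (towerP L m (n + 1)) => c₀) W f b‖ ≤ M) (μ : Fin d) (b : Bond d (towerP L m (n + 1))),
        ‖WL2.equiv ℂ (fun _ : Bond d (towerP L m (n + 1)) => c₀) W (covDerivL2K ℂ c₀ ((η : ℂ))⁻¹ (adTransportW φ U)
            ((WL2.equiv ℂ (fun _ : TSite d (towerP L m (n + 1)) => c₀) W).symm fun y =>
              WL2.equiv ℂ (fun _ : Bond d (towerP L m (n + 1)) => c₀) W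
                (G1LatticeK hposπ (covDerivL2K ℂ c₀ ((η : ℂ))⁻¹ (adTransportW φ U) (RofUk L m n φ η U
                  (covDivL2K ℂ c₀ ((η : ℂ))⁻¹ (adTransportW φ fun bb => (U bb)⁻¹) (G1LatticeK hposπ f))))) (y, μ))) b‖ ≤ B * M := by
  classical
  obtain ⟨α₃, B₃, δ₃, hα₃, hB₃, hδ₃, H⟩ := H3
  have hK : 0 ≤ latticeConst d δ₃ := latticeConst_nonneg d hδ₃.le
  refine ⟨α₃, B₃ * latticeConst d δ₃, hα₃, mul_nonneg hB₃ hK, ?_⟩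
  intro n η hηL c₀ c₁ _ _ hw hρ m _ hm U αU hα0 hα1 hU1 hreg εU hεU hUε hLb α hα hαle hUst hUb hUη hpl hUgrad hRlev hεg hAQ hpos' hpos hposπ hc₀ hJ
    f M hM0 hfM μ b
  have Hk := H n η hηL c₀ c₁ hw hρ m hm U αU hα0 hα1 hU1 hreg εU hεU hUε hLb α hα hαle hUst hUb hUη hpl hUgrad hRlev hεg hAQ hpos' hpos hposπ hc₀ hJ
  -- the third word's slice derivative read on the plain bond functions
  obtain ⟨TD, hTD⟩ : ∃ T : (Bond d (towerP L m (n + 1)) → W) →ₗ[ℂ] (Bond d (towerP L m (n + 1)) → W),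
      ∀ g x, T g x = WL2.equiv ℂ (fun _ : Bond d (towerP L m (n + 1)) => c₀) W (covDerivL2K ℂ c₀ ((η : ℂ))⁻¹ (adTransportW φ U)
        ((WL2.equiv ℂ (fun _ : TSite d (towerP L m (n + 1)) => c₀) W).symm fun y =>
          WL2.equiv ℂ (fun _ : Bond d (towerP L m (n + 1)) => c₀) W
            (G1LatticeK hposπ (covDerivL2K ℂ c₀ ((η : ℂ))⁻¹ (adTransportW φ U) (RofUk L m n φ η U
              (covDivL2K ℂ c₀ ((η : ℂ))⁻¹ (adTransportW φ fun bb => (U bb)⁻¹)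
                (G1LatticeK hposπ (((WL2.equiv ℂ (fun _ : Bond d (towerP L m (n + 1)) => c₀) W)).symm g)))))) (y, μ))) x :=
    ⟨(WL2.linearEquiv ℂ ℂ (fun _ : Bond d (towerP L m (n + 1)) => c₀)).toLinearMap ∘ₗ
      (covDerivL2K ℂ c₀ ((η : ℂ))⁻¹ (adTransportW φ U) ∘ₗ
        (WL2.linearEquiv ℂ ℂ (fun _ : TSite d (towerP L m (n + 1)) => c₀)).symm.toLinearMap ∘ₗ
        LinearMap.funLeft ℂ W (fun y' : TSite d (towerP L m (n + 1)) => ((y', μ) : Bond d (towerP L m (n + 1)))) ∘ₗ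
        (WL2.linearEquiv ℂ ℂ (fun _ : Bond d (towerP L m (n + 1)) => c₀)).toLinearMap) ∘ₗ
      (G1LatticeK hposπ ∘ₗ covDerivL2K ℂ c₀ ((η : ℂ))⁻¹ (adTransportW φ U) ∘ₗ RofUk L m n φ η U ∘ₗ
        covDivL2K ℂ c₀ ((η : ℂ))⁻¹ (adTransportW φ fun bb => (U bb)⁻¹) ∘ₗ G1LatticeK hposπ) ∘ₗ
      (WL2.linearEquiv ℂ ℂ (fun _ : Bond d (towerP L m (n + 1)) => c₀)).symm.toLinearMap, fun _ _ => rfl⟩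
  have hloc : ∀ (v : TSite d m) (g : Bond d (towerP L m (n + 1)) → W) (F : ℝ),
      (∀ y, blockCoord (L ^ (n + 1)) m (siteCast (towerP_eq_fineP_pow L m (n + 1)) (bpos y)) ≠ v → g y = 0) → (∀ y, ‖g y‖ ≤ F) →
      ∀ x, ‖TD g x‖ ≤ B₃ * Real.exp (-(δ₃ * tdist m (blockCoord (L ^ (n + 1)) m (siteCast (towerP_eq_fineP_pow L m (n + 1)) (bpos x))) v)) * F := by
    intro v g F hgv hgF x
    rw [hTD]
    exact Hk v (((WL2.equiv ℂ (fun _ : Bond d (towerP L m (n + 1)) => c₀) W)).symm g) F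
      (fun y hy => by rw [Equiv.apply_symm_apply]; exact hgv y hy) (fun y => by rw [Equiv.apply_symm_apply]; exact hgF y) μ x
  have hD := norm_apply_le_of_local
    (fun y : Bond d (towerP L m (n + 1)) => blockCoord (L ^ (n + 1)) m (siteCast (towerP_eq_fineP_pow L m (n + 1)) (bpos y)))
    (fun x : Bond d (towerP L m (n + 1)) => blockCoord (L ^ (n + 1)) m (siteCast (towerP_eq_fineP_pow L m (n + 1)) (bpos x)))
    (tdist m) TD hB₃ hloc (fun u => torusSum_le d hm hδ₃ u) (WL2.equiv ℂ (fun _ : Bond d (towerP L m (n + 1)) => c₀) W f) hM0 hfM b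
  rw [hTD, Equiv.symm_apply_apply] at hD
  exact hD


set_option maxHeartbeats 800000 in -- four ≈ 50-binder suppliers read once each + the three-word defeq unfolding: the assembly exceeds the default budget (as (K85) ∕ J-3)
include hd hL hL3 hMφ hMφ' hφ hφ' hstar ha ha' hϱ0 hϱ1 hτ hCτ hτm hMτ hρw hτ₁ hτ₂ hφτ in
/-- **§2 THE GLOBAL sup → sup LETTERS OF `𝔊̃_k` — VALUE, SLICE GRADIENT, COVARIANT GRADIENT — MODULO THE THIRD WORD's LOCAL GRADIENT ROW `H3`**: `∃ (α₁, j₁, B)`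
BEFORE (K86)'s binder block; `𝔊̃_kf = G̃_kf − H̃_k(Q_k(G̃_kf)) − G̃_k(D_U(R_k(D*_U(G̃_kf))))` (`frakGLin_apply`, `H1LatticeK_eq`), the value letter is (K86) by name, the
slice-gradient letter is (T4C).3 + J-3.2 + §1 (the owner's window `‖J‖ ≤ α` served at the radius `max(α, j₀)`), the covariant gradient by `norm_covGrad_apply_le_of_slice`.
[cite: Balaban1985BackgroundPropagators, Thm 3.13 p.426, (3.153) p.426, Thm 3.1 (3.47) p.398; Balaban1985Variational, (110)–(111) p.294, (117) p.295] -/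
theorem exists_global_supGrad_frakGLatticeKPi_of_thirdWord
    (H3 : ∃ α₃ B₃ δ₃ : ℝ, 0 < α₃ ∧ 0 ≤ B₃ ∧ 0 < δ₃ ∧
      ∀ (n : ℕ) (η : ℝ) (_hηL : η * (L : ℝ) ^ (n + 1) = 1) (c₀ c₁ : ℝ) [Fact (0 < c₀)] [Fact (0 < c₁)]
        (_hw : c₀ * ((L : ℝ) ^ (n + 1)) ^ d = c₁) (_hρ : |η| ^ d / c₀ ≤ ρw) (m : Fin d → ℕ) [∀ i, NeZero (m i)] (_hm : ∀ i, 1 ≤ m i)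
        (U : Bond d (towerP L m (n + 1)) → 𝔸ˣ) (αU : ℕ → ℝ) (_hα0 : ∀ j, 0 ≤ αU j) (hα1 : ∀ j, αU j ≤ 1 / 64)
        (hU1 : ∀ (j : ℕ) (x : B7Prop1Explicit.Site d) (k : Fin d), perCfg (towerP L m (j + 1)) (UlevOf L m (n + 1) U j) x k ∈ U1 𝔸)
        (hreg : ∀ (j : ℕ) (y : TSite d (towerP L m j)) (k : Fin d) (ρ' : Fin d → Fin L),
          ‖((Wcx L (perCfg (towerP L m (j + 1)) (UlevOf L m (n + 1) U j)) (cornerSite L y) k (boxVec L ρ') : 𝔸ˣ) : 𝔸) - 1‖ ≤ αU j)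
        (εU : ℕ → ℝ) (_hεU : ∀ j, 0 ≤ εU j) (_hUε : ∀ (j : ℕ) (b : Bond d (towerP L m (j + 1))), ‖(UlevOf L m (n + 1) U j b : 𝔸) - 1‖ ≤ εU j)
        (_hLb : ∀ (j : ℕ) (b : Bond d (towerP L m (j + 1))), UlevOf L m (n + 1) U j b ∈ U1 𝔸)
        (α : ℝ) (_hα : 0 ≤ α) (_hαle : α ≤ α₃)
        (hUst : ∀ b, star (U b : 𝔸) = (((U b)⁻¹ : 𝔸ˣ) : 𝔸)) (_hUb : ∀ b, U b ∈ U1 𝔸) (_hUη : ∀ b, ‖(U b : 𝔸) - 1‖ ≤ α * η)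
        (_hpl : ∀ p : B9SectCLatticeCarrier.Plaq d (towerP L m (n + 1)), ‖(plaqHolU U p : 𝔸) - 1‖ ≤ α * η ^ 2)
        (_hUgrad : ∀ (x : TSite d (towerP L m (n + 1))) (μ : Fin d), ‖(U (x, μ) : 𝔸) - U (unshift μ x, μ)‖ ≤ α * η ^ 2)
        (_hRlev : ∀ (j : ℕ) (b : Bond d (towerP L m (j + 1))) (w : W), ‖adTransportW φ (UlevOf L m (n + 1) U j) b w‖ ≤ ‖w‖)
        (_hεg : ∀ j < n + 1, εU j ≤ α * ϱ ^ j) (_hAQ : ∑ j ∈ Finset.range (n + 1), αU j ≤ AQ)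
        (hpos' : ∀ x : SiteL2K ℂ d (towerP L m (n + 1)) c₀ W, x ≠ 0 → 0 < RCLike.re ⟪x, laplacePrimeAk L m n φ η U a' (c₁ := c₁) x⟫_ℂ)
        (hpos : ∀ x : BondL2K ℂ d (towerP L m (n + 1)) c₀ W, x ≠ 0 →
          0 < RCLike.re ⟪x, laplaceAk L m n φ η U hL αU hα1 hU1 hreg τ (c₀ := c₀) (c₁ := c₁) a x⟫_ℂ)
        (hposπ : ∀ x : BondL2K ℂ d (towerP L m (n + 1)) c₀ W, x ≠ 0 →
          0 < RCLike.re ⟪x, laplaceAkPi L m n φ τ η U a' hpos' hL αU hα1 hU1 hreg (c₁ := c₁) a x⟫_ℂ)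
        (_hc₀ : c₀ = η ^ d)
        (_hJ : ∀ (μ : Fin d) (y : TSite d (towerP L m (n + 1))),
          ‖B9Eq39Adjoint.J (fun μ => B9Eq33CovDerivVector.shiftEquiv μ) (fun μ y => U (y, μ)) η μ y‖ ≤ α)
        (v : TSite d m) (f : BondL2K ℂ d (towerP L m (n + 1)) c₀ W) (F : ℝ)
        (_hfv : ∀ b, blockCoord (L ^ (n + 1)) m (siteCast (towerP_eq_fineP_pow L m (n + 1)) (bpos b)) ≠ v →
          WL2.equiv ℂ (fun _ : Bond d (towerP L m (n + 1)) => c₀) W f b = 0)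
        (_hfF : ∀ b, ‖WL2.equiv ℂ (fun _ : Bond d (towerP L m (n + 1)) => c₀) W f b‖ ≤ F) (μ : Fin d) (b : Bond d (towerP L m (n + 1))),
        ‖WL2.equiv ℂ (fun _ : Bond d (towerP L m (n + 1)) => c₀) W (covDerivL2K ℂ c₀ ((η : ℂ))⁻¹ (adTransportW φ U)
            ((WL2.equiv ℂ (fun _ : TSite d (towerP L m (n + 1)) => c₀) W).symm fun y =>
              WL2.equiv ℂ (fun _ : Bond d (towerP L m (n + 1)) => c₀) W
                (G1LatticeK hposπ (covDerivL2K ℂ c₀ ((η : ℂ))⁻¹ (adTransportW φ U) (RofUk L m n φ η U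
                  (covDivL2K ℂ c₀ ((η : ℂ))⁻¹ (adTransportW φ fun bb => (U bb)⁻¹) (G1LatticeK hposπ f))))) (y, μ))) b‖ ≤
          B₃ * Real.exp (-(δ₃ * tdist m (blockCoord (L ^ (n + 1)) m (siteCast (towerP_eq_fineP_pow L m (n + 1)) (bpos b))) v)) * F) :
    ∃ α₁ j₁ B : ℝ, 0 < α₁ ∧ 0 < j₁ ∧ 0 ≤ B ∧
      ∀ (n : ℕ) (η : ℝ) (_hηL : η * (L : ℝ) ^ (n + 1) = 1) (c₀ c₁ : ℝ) [Fact (0 < c₀)] [Fact (0 < c₁)]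
        (_hw : c₀ * ((L : ℝ) ^ (n + 1)) ^ d = c₁) (_hρ : |η| ^ d / c₀ ≤ ρw) (m : Fin d → ℕ) [∀ i, NeZero (m i)] (_hm : ∀ i, 1 ≤ m i)
        (U : Bond d (towerP L m (n + 1)) → 𝔸ˣ) (αU : ℕ → ℝ) (_hα0 : ∀ j, 0 ≤ αU j) (hα1 : ∀ j, αU j ≤ 1 / 64)
        (hαL : ∀ j, 50 * (d + 1) * αU j * (L : ℝ) ^ d ≤ 1 / 2)
        (hU1 : ∀ (j : ℕ) (x : B7Prop1Explicit.Site d) (k : Fin d), perCfg (towerP L m (j + 1)) (UlevOf L m (n + 1) U j) x k ∈ U1 𝔸)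
        (hreg : ∀ (j : ℕ) (y : TSite d (towerP L m j)) (k : Fin d) (ρ' : Fin d → Fin L),
          ‖((Wcx L (perCfg (towerP L m (j + 1)) (UlevOf L m (n + 1) U j)) (cornerSite L y) k (boxVec L ρ') : 𝔸ˣ) : 𝔸) - 1‖ ≤ αU j)
        (εU : ℕ → ℝ) (_hεU : ∀ j, 0 ≤ εU j) (_hUε : ∀ (j : ℕ) (b : Bond d (towerP L m (j + 1))), ‖(UlevOf L m (n + 1) U j b : 𝔸) - 1‖ ≤ εU j)
        (_hLb : ∀ (j : ℕ) (b : Bond d (towerP L m (j + 1))), UlevOf L m (n + 1) U j b ∈ U1 𝔸)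
        (α : ℝ) (_hα : 0 ≤ α) (_hαle : α ≤ α₁)
        (hUst : ∀ b, star (U b : 𝔸) = (((U b)⁻¹ : 𝔸ˣ) : 𝔸)) (_hUb : ∀ b, U b ∈ U1 𝔸) (_hUη : ∀ b, ‖(U b : 𝔸) - 1‖ ≤ α * η)
        (_hpl : ∀ p : B9SectCLatticeCarrier.Plaq d (towerP L m (n + 1)), ‖(plaqHolU U p : 𝔸) - 1‖ ≤ α * η ^ 2)
        (_hUgrad : ∀ (x : TSite d (towerP L m (n + 1))) (μ : Fin d), ‖(U (x, μ) : 𝔸) - U (unshift μ x, μ)‖ ≤ α * η ^ 2)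
        (_hRlev : ∀ (j : ℕ) (b : Bond d (towerP L m (j + 1))) (w : W), ‖adTransportW φ (UlevOf L m (n + 1) U j) b w‖ ≤ ‖w‖)
        (_hεg : ∀ j < n + 1, εU j ≤ α * ϱ ^ j) (_hAQ : ∑ j ∈ Finset.range (n + 1), αU j ≤ AQ)
        (hpos' : ∀ x : SiteL2K ℂ d (towerP L m (n + 1)) c₀ W, x ≠ 0 → 0 < RCLike.re ⟪x, laplacePrimeAk L m n φ η U a' (c₁ := c₁) x⟫_ℂ)
        (hpos : ∀ x : BondL2K ℂ d (towerP L m (n + 1)) c₀ W, x ≠ 0 →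
          0 < RCLike.re ⟪x, laplaceAk L m n φ η U hL αU hα1 hU1 hreg τ (c₀ := c₀) (c₁ := c₁) a x⟫_ℂ)
        (_hc₀η : c₀ = η ^ d) (j₀ : ℝ) (_hJ : ∀ μ y, ‖B9Eq39Adjoint.J (fun μ => B9Eq33CovDerivVector.shiftEquiv μ) (fun μ y => U (y, μ)) η μ y‖ ≤ j₀) (_hj : j₀ ≤ j₁)
        (hposπ : ∀ x : BondL2K ℂ d (towerP L m (n + 1)) c₀ W, x ≠ 0 →
          0 < RCLike.re ⟪x, laplaceAkPi L m n φ τ η U a' hpos' hL αU hα1 hU1 hreg (c₁ := c₁) a x⟫_ℂ)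
        (hQ : Function.Surjective (QkW L m n φ U hL αU hα1 hU1 hreg (c₀ := c₀) (c₁ := c₁)))
        (f : BondL2K ℂ d (towerP L m (n + 1)) c₀ W) (M : ℝ) (_hM : 0 ≤ M)
        (_hfM : ∀ b, ‖WL2.equiv ℂ (fun _ : Bond d (towerP L m (n + 1)) => c₀) W f b‖ ≤ M) (μ : Fin d) (b : Bond d (towerP L m (n + 1))),
        ‖WL2.equiv ℂ (fun _ : Bond d (towerP L m (n + 1)) => c₀) W (frakGLatticeK hposπ hQ f) b‖ ≤ B * M ∧
        ‖WL2.equiv ℂ (fun _ : Bond d (towerP L m (n + 1)) => c₀) W (covDerivL2K ℂ c₀ ((η : ℂ))⁻¹ (adTransportW φ U)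
            ((WL2.equiv ℂ (fun _ : TSite d (towerP L m (n + 1)) => c₀) W).symm fun y => WL2.equiv ℂ (fun _ : Bond d (towerP L m (n + 1)) => c₀) W (frakGLatticeK hposπ hQ f) (y, μ))) b‖ ≤ B * M ∧
        ‖covGrad ((η : ℂ))⁻¹ (adTransportW φ U) (WL2.equiv ℂ (fun _ : Bond d (towerP L m (n + 1)) => c₀) W (frakGLatticeK hposπ hQ f)) (b, μ)‖ ≤ B * M := by
  classical
  obtain ⟨αV, jV, BV, hαV, hjV, hBV, HV⟩ :=
    exists_global_row_frakGLatticeKPi hd L hL hL3 φ hMφ hMφ' hφ hφ' hstar ha ha' hϱ0 hϱ1 τ hτ hCτ hτm hMτ hρw hτ₁ hτ₂ hφτ AQ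
  obtain ⟨αG, BG, hαG, hBG, HG⟩ := exists_global_rows_G1kPi hd L hL hL3 φ hMφ hMφ' hφ hφ' hstar ha ha' hϱ0 hϱ1 τ hτ hCτ hτm hMτ hρw hτ₁ hτ₂ hφτ AQ
  obtain ⟨αM, jM, BM, hαM, hjM, hBM, HM⟩ :=
    exists_global_supGrad_H1kPiQkG1kPi hd L hL hL3 φ hMφ hMφ' hφ hφ' hstar ha ha' hϱ0 hϱ1 τ hτ hCτ hτm hMτ hρw hτ₁ hτ₂ hφτ AQ
  obtain ⟨αE, BE, hαE, hBE, HE⟩ := exists_global_gradLetter_thirdWord_of_local L hL φ τ AQ H3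
  obtain ⟨Bs, hBs⟩ : ∃ B : ℝ, B = BV + (BG + BM + BE) := ⟨_, rfl⟩
  have hBs0 : 0 ≤ Bs := by rw [hBs]; positivity
  refine ⟨min (min αV αM) (min αG αE), min (min jV jM) (min αG αE), Bs, lt_min (lt_min hαV hαM) (lt_min hαG hαE),
    lt_min (lt_min hjV hjM) (lt_min hαG hαE), hBs0, ?_⟩
  intro n η hηL c₀ c₁ _ _ hw hρ m _ hm U αU hα0 hα1 hαL hU1 hreg εU hεU hUε hLb α hα hαle hUst hUb hUη hpl hUgrad hRlev hεg hAQ hpos' hpos hc₀η j₀ hJ hj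
    hposπ hQ f M hM0 hfM μ b
  have hη : 0 < η := by
    have hLp : (0 : ℝ) < (L : ℝ) ^ (n + 1) := pow_pos (Nat.cast_pos.2 hL) _
    by_contra h
    have : η * (L : ℝ) ^ (n + 1) ≤ 0 := mul_nonpos_of_nonpos_of_nonneg (not_lt.mp h) hLp.le
    linarith only [this, hηL]
  have hαV' : α ≤ αV := hαle.trans ((min_le_left _ _).trans (min_le_left _ _))
  have hαM' : α ≤ αM := hαle.trans ((min_le_left _ _).trans (min_le_right _ _))
  have hjV' : j₀ ≤ jV := hj.trans ((min_le_left _ _).trans (min_le_left _ _))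
  have hjM' : j₀ ≤ jM := hj.trans ((min_le_left _ _).trans (min_le_right _ _))
  -- the owner's window at the enlarged radius `α′ = max α j₀`
  have hα'0 : 0 ≤ max α j₀ := hα.trans (le_max_left _ _)
  have hα'G : max α j₀ ≤ αG := max_le (hαle.trans ((min_le_right _ _).trans (min_le_left _ _))) (hj.trans ((min_le_right _ _).trans (min_le_left _ _)))
  have hα'E : max α j₀ ≤ αE := max_le (hαle.trans ((min_le_right _ _).trans (min_le_right _ _))) (hj.trans ((min_le_right _ _).trans (min_le_right _ _)))
  have hUη' : ∀ bb, ‖(U bb : 𝔸) - 1‖ ≤ max α j₀ * η := fun bb => (hUη bb).trans (mul_le_mul_of_nonneg_right (le_max_left _ _) hη.le)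
  have hpl' : ∀ p : B9SectCLatticeCarrier.Plaq d (towerP L m (n + 1)), ‖(plaqHolU U p : 𝔸) - 1‖ ≤ max α j₀ * η ^ 2 := fun p =>
    (hpl p).trans (mul_le_mul_of_nonneg_right (le_max_left _ _) (sq_nonneg η))
  have hUgrad' : ∀ (x : TSite d (towerP L m (n + 1))) (μ : Fin d), ‖(U (x, μ) : 𝔸) - U (unshift μ x, μ)‖ ≤ max α j₀ * η ^ 2 := fun x μ =>
    (hUgrad x μ).trans (mul_le_mul_of_nonneg_right (le_max_left _ _) (sq_nonneg η))
  have hεg' : ∀ j < n + 1, εU j ≤ max α j₀ * ϱ ^ j := fun j hjn => (hεg j hjn).trans (mul_le_mul_of_nonneg_right (le_max_left _ _) (pow_nonneg hϱ0 j))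
  have hJ' : ∀ (μ : Fin d) (y : TSite d (towerP L m (n + 1))),
      ‖B9Eq39Adjoint.J (fun μ => B9Eq33CovDerivVector.shiftEquiv μ) (fun μ y => U (y, μ)) η μ y‖ ≤ max α j₀ := fun μ y => (hJ μ y).trans (le_max_right _ _)
  -- the four global letters
  have a0 : ‖WL2.equiv ℂ (fun _ : Bond d (towerP L m (n + 1)) => c₀) W (frakGLatticeK hposπ hQ f) b‖ ≤ BV * M :=
    HV n η hηL c₀ c₁ hw hρ m hm U αU hα0 hα1 hαL hU1 hreg εU hεU hUε hLb α hα hαV' hUst hUb hUη hpl hUgrad hRlev hεg hAQ hpos' hpos hc₀η j₀ hJ hjV' hposπ hQ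
      f M hM0 hfM b
  have a1 : ‖WL2.equiv ℂ (fun _ : Bond d (towerP L m (n + 1)) => c₀) W (covDerivL2K ℂ c₀ ((η : ℂ))⁻¹ (adTransportW φ U)
      ((WL2.equiv ℂ (fun _ : TSite d (towerP L m (n + 1)) => c₀) W).symm fun y' => WL2.equiv ℂ (fun _ : Bond d (towerP L m (n + 1)) => c₀) W (G1LatticeK hposπ f) (y', μ))) b‖ ≤ BG * M :=
    (HG n η hηL c₀ c₁ hw hρ m hm U αU hα0 hα1 hU1 hreg εU hεU hUε hLb (max α j₀) hα'0 hα'G hUst hUb hUη' hpl' hUgrad' hRlev hεg' hAQ hpos' hpos hposπ hc₀η hJ'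
      f M hM0 hfM μ b (bpos b)).2.2.1
  have a2 : ‖WL2.equiv ℂ (fun _ : Bond d (towerP L m (n + 1)) => c₀) W (covDerivL2K ℂ c₀ ((η : ℂ))⁻¹ (adTransportW φ U)
      ((WL2.equiv ℂ (fun _ : TSite d (towerP L m (n + 1)) => c₀) W).symm fun y => WL2.equiv ℂ (fun _ : Bond d (towerP L m (n + 1)) => c₀) W
        (H1LatticeK hposπ hQ (QkW L m n φ U hL αU hα1 hU1 hreg (c₀ := c₀) (c₁ := c₁) (G1LatticeK hposπ f))) (y, μ))) b‖ ≤ BM * M :=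
    (HM n η hηL c₀ c₁ hw hρ m hm U αU hα0 hα1 hαL hU1 hreg εU hεU hUε hLb α hα hαM' hUst hUb hUη hpl hUgrad hRlev hεg hAQ hpos' hpos hc₀η j₀ hJ hjM' hposπ hQ
      f M hM0 hfM μ b).2.1
  have a3 : ‖WL2.equiv ℂ (fun _ : Bond d (towerP L m (n + 1)) => c₀) W (covDerivL2K ℂ c₀ ((η : ℂ))⁻¹ (adTransportW φ U)
      ((WL2.equiv ℂ (fun _ : TSite d (towerP L m (n + 1)) => c₀) W).symm fun y => WL2.equiv ℂ (fun _ : Bond d (towerP L m (n + 1)) => c₀) W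
        (G1LatticeK hposπ (covDerivL2K ℂ c₀ ((η : ℂ))⁻¹ (adTransportW φ U) (RofUk L m n φ η U
          (covDivL2K ℂ c₀ ((η : ℂ))⁻¹ (adTransportW φ fun bb => (U bb)⁻¹) (G1LatticeK hposπ f))))) (y, μ))) b‖ ≤ BE * M :=
    HE n η hηL c₀ c₁ hw hρ m hm U αU hα0 hα1 hU1 hreg εU hεU hUε hLb (max α j₀) hα'0 hα'E hUst hUb hUη' hpl' hUgrad' hRlev hεg' hAQ hpos' hpos hposπ hc₀η hJ'
      f M hM0 hfM μ b
  -- `𝔊̃_k f` unfolded and the slice derivative as a linear map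
  have e : frakGLatticeK hposπ hQ f = G1LatticeK hposπ f - H1LatticeK hposπ hQ (QkW L m n φ U hL αU hα1 hU1 hreg (c₀ := c₀) (c₁ := c₁) (G1LatticeK hposπ f)) -
      G1LatticeK hposπ (covDerivL2K ℂ c₀ ((η : ℂ))⁻¹ (adTransportW φ U) (RofUk L m n φ η U (covDivL2K ℂ c₀ ((η : ℂ))⁻¹ (adTransportW φ fun bb => (U bb)⁻¹) (G1LatticeK hposπ f)))) := by
    unfold frakGLatticeK
    rw [frakGLin_apply, H1LatticeK_eq]
    rfl
  obtain ⟨S, hS⟩ : ∃ S : BondL2K ℂ d (towerP L m (n + 1)) c₀ W →ₗ[ℂ] BondL2K ℂ d (towerP L m (n + 1)) c₀ W,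
      ∀ u, S u = covDerivL2K ℂ c₀ ((η : ℂ))⁻¹ (adTransportW φ U) ((WL2.equiv ℂ (fun _ : TSite d (towerP L m (n + 1)) => c₀) W).symm fun y => WL2.equiv ℂ (fun _ : Bond d (towerP L m (n + 1)) => c₀) W u (y, μ)) :=
    ⟨covDerivL2K ℂ c₀ ((η : ℂ))⁻¹ (adTransportW φ U) ∘ₗ
        (WL2.linearEquiv ℂ ℂ (fun _ : TSite d (towerP L m (n + 1)) => c₀)).symm.toLinearMap ∘ₗ
        LinearMap.funLeft ℂ W (fun y' : TSite d (towerP L m (n + 1)) => ((y', μ) : Bond d (towerP L m (n + 1)))) ∘ₗ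
        (WL2.linearEquiv ℂ ℂ (fun _ : Bond d (towerP L m (n + 1)) => c₀)).toLinearMap, fun _ => rfl⟩
  have hslice : ‖WL2.equiv ℂ (fun _ : Bond d (towerP L m (n + 1)) => c₀) W (covDerivL2K ℂ c₀ ((η : ℂ))⁻¹ (adTransportW φ U)
      ((WL2.equiv ℂ (fun _ : TSite d (towerP L m (n + 1)) => c₀) W).symm fun y => WL2.equiv ℂ (fun _ : Bond d (towerP L m (n + 1)) => c₀) W (frakGLatticeK hposπ hQ f) (y, μ))) b‖ ≤ (BG + BM + BE) * M := by
    rw [← hS, e]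
    simp only [map_sub, WL2.equiv_sub, Pi.sub_apply]
    rw [hS, hS, hS]
    refine (norm_sub_le _ _).trans ((add_le_add (norm_sub_le _ _) le_rfl).trans ?_)
    calc _ ≤ BG * M + BM * M + BE * M := add_le_add (add_le_add a1 a2) a3
      _ = (BG + BM + BE) * M := by ring
  have hBV' : BV * M ≤ Bs * M := mul_le_mul_of_nonneg_right (by rw [hBs]; linarith [add_nonneg (add_nonneg hBG hBM) hBE]) hM0
  have hBD' : (BG + BM + BE) * M ≤ Bs * M := mul_le_mul_of_nonneg_right (by rw [hBs]; linarith) hM0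
  exact ⟨a0.trans hBV', hslice.trans hBD', norm_covGrad_apply_le_of_slice _ _ _ b μ (hslice.trans hBD')⟩

set_option maxHeartbeats 800000 in -- §2's block + the (115) socket: as the owner's (T4F)
include hd hL hL3 hMφ hMφ' hφ hφ' hstar ha ha' hϱ0 hϱ1 hτ hCτ hτm hMτ hρw hτ₁ hτ₂ hφτ in
/-- **§3 THE (117) SOCKET FOR THE FULL `𝔊̃_k`, MODULO THE THIRD WORD's LOCAL GRADIENT ROW `H3`** — `‖toCLM115 ∇_U 𝔊̃_k‖ ≤ max(w̄₀·B, w̄₁·B)·w̲⁻¹`, ONE height-free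
`B`, for every height, spacing on the diagonal, period, background of the MODEL letters in the window `α ≤ α₁`, `‖J‖ ≤ j₀ ≤ j₁`, ANY positivity witnesses, `hQ`, print's
weight and ANY level functions ∕ weight parameters of (115): the owner's `norm_toCLM115_le_of_comp` fed by §2's value and covariant-gradient letters (pattern (T4F) ∕ J-4).
[cite: Balaban1985Variational, (117) p.295, (115) p.294, (110)–(111) p.294; Balaban1985BackgroundPropagators, Thm 3.13 p.426, (3.153) p.426] -/
theorem exists_norm_toCLM115_frakGkPi_le_of_thirdWord
    (H3 : ∃ α₃ B₃ δ₃ : ℝ, 0 < α₃ ∧ 0 ≤ B₃ ∧ 0 < δ₃ ∧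
      ∀ (n : ℕ) (η : ℝ) (_hηL : η * (L : ℝ) ^ (n + 1) = 1) (c₀ c₁ : ℝ) [Fact (0 < c₀)] [Fact (0 < c₁)]
        (_hw : c₀ * ((L : ℝ) ^ (n + 1)) ^ d = c₁) (_hρ : |η| ^ d / c₀ ≤ ρw) (m : Fin d → ℕ) [∀ i, NeZero (m i)] (_hm : ∀ i, 1 ≤ m i)
        (U : Bond d (towerP L m (n + 1)) → 𝔸ˣ) (αU : ℕ → ℝ) (_hα0 : ∀ j, 0 ≤ αU j) (hα1 : ∀ j, αU j ≤ 1 / 64)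
        (hU1 : ∀ (j : ℕ) (x : B7Prop1Explicit.Site d) (k : Fin d), perCfg (towerP L m (j + 1)) (UlevOf L m (n + 1) U j) x k ∈ U1 𝔸)
        (hreg : ∀ (j : ℕ) (y : TSite d (towerP L m j)) (k : Fin d) (ρ' : Fin d → Fin L),
          ‖((Wcx L (perCfg (towerP L m (j + 1)) (UlevOf L m (n + 1) U j)) (cornerSite L y) k (boxVec L ρ') : 𝔸ˣ) : 𝔸) - 1‖ ≤ αU j)
        (εU : ℕ → ℝ) (_hεU : ∀ j, 0 ≤ εU j) (_hUε : ∀ (j : ℕ) (b : Bond d (towerP L m (j + 1))), ‖(UlevOf L m (n + 1) U j b : 𝔸) - 1‖ ≤ εU j)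
        (_hLb : ∀ (j : ℕ) (b : Bond d (towerP L m (j + 1))), UlevOf L m (n + 1) U j b ∈ U1 𝔸)
        (α : ℝ) (_hα : 0 ≤ α) (_hαle : α ≤ α₃)
        (hUst : ∀ b, star (U b : 𝔸) = (((U b)⁻¹ : 𝔸ˣ) : 𝔸)) (_hUb : ∀ b, U b ∈ U1 𝔸) (_hUη : ∀ b, ‖(U b : 𝔸) - 1‖ ≤ α * η)
        (_hpl : ∀ p : B9SectCLatticeCarrier.Plaq d (towerP L m (n + 1)), ‖(plaqHolU U p : 𝔸) - 1‖ ≤ α * η ^ 2)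
        (_hUgrad : ∀ (x : TSite d (towerP L m (n + 1))) (μ : Fin d), ‖(U (x, μ) : 𝔸) - U (unshift μ x, μ)‖ ≤ α * η ^ 2)
        (_hRlev : ∀ (j : ℕ) (b : Bond d (towerP L m (j + 1))) (w : W), ‖adTransportW φ (UlevOf L m (n + 1) U j) b w‖ ≤ ‖w‖)
        (_hεg : ∀ j < n + 1, εU j ≤ α * ϱ ^ j) (_hAQ : ∑ j ∈ Finset.range (n + 1), αU j ≤ AQ)
        (hpos' : ∀ x : SiteL2K ℂ d (towerP L m (n + 1)) c₀ W, x ≠ 0 → 0 < RCLike.re ⟪x, laplacePrimeAk L m n φ η U a' (c₁ := c₁) x⟫_ℂ)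
        (hpos : ∀ x : BondL2K ℂ d (towerP L m (n + 1)) c₀ W, x ≠ 0 →
          0 < RCLike.re ⟪x, laplaceAk L m n φ η U hL αU hα1 hU1 hreg τ (c₀ := c₀) (c₁ := c₁) a x⟫_ℂ)
        (hposπ : ∀ x : BondL2K ℂ d (towerP L m (n + 1)) c₀ W, x ≠ 0 →
          0 < RCLike.re ⟪x, laplaceAkPi L m n φ τ η U a' hpos' hL αU hα1 hU1 hreg (c₁ := c₁) a x⟫_ℂ)
        (_hc₀ : c₀ = η ^ d)
        (_hJ : ∀ (μ : Fin d) (y : TSite d (towerP L m (n + 1))),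
          ‖B9Eq39Adjoint.J (fun μ => B9Eq33CovDerivVector.shiftEquiv μ) (fun μ y => U (y, μ)) η μ y‖ ≤ α)
        (v : TSite d m) (f : BondL2K ℂ d (towerP L m (n + 1)) c₀ W) (F : ℝ)
        (_hfv : ∀ b, blockCoord (L ^ (n + 1)) m (siteCast (towerP_eq_fineP_pow L m (n + 1)) (bpos b)) ≠ v →
          WL2.equiv ℂ (fun _ : Bond d (towerP L m (n + 1)) => c₀) W f b = 0)
        (_hfF : ∀ b, ‖WL2.equiv ℂ (fun _ : Bond d (towerP L m (n + 1)) => c₀) W f b‖ ≤ F) (μ : Fin d) (b : Bond d (towerP L m (n + 1))),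
        ‖WL2.equiv ℂ (fun _ : Bond d (towerP L m (n + 1)) => c₀) W (covDerivL2K ℂ c₀ ((η : ℂ))⁻¹ (adTransportW φ U)
            ((WL2.equiv ℂ (fun _ : TSite d (towerP L m (n + 1)) => c₀) W).symm fun y =>
              WL2.equiv ℂ (fun _ : Bond d (towerP L m (n + 1)) => c₀) W
                (G1LatticeK hposπ (covDerivL2K ℂ c₀ ((η : ℂ))⁻¹ (adTransportW φ U) (RofUk L m n φ η U
                  (covDivL2K ℂ c₀ ((η : ℂ))⁻¹ (adTransportW φ fun bb => (U bb)⁻¹) (G1LatticeK hposπ f))))) (y, μ))) b‖ ≤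
          B₃ * Real.exp (-(δ₃ * tdist m (blockCoord (L ^ (n + 1)) m (siteCast (towerP_eq_fineP_pow L m (n + 1)) (bpos b))) v)) * F) :
    ∃ α₁ j₁ B : ℝ, 0 < α₁ ∧ 0 < j₁ ∧ 0 ≤ B ∧
      ∀ (n : ℕ) (η : ℝ) (_hηL : η * (L : ℝ) ^ (n + 1) = 1) (c₀ c₁ : ℝ) [Fact (0 < c₀)] [Fact (0 < c₁)]
        (_hw : c₀ * ((L : ℝ) ^ (n + 1)) ^ d = c₁) (_hρ : |η| ^ d / c₀ ≤ ρw) (m : Fin d → ℕ) [∀ i, NeZero (m i)] (_hm : ∀ i, 1 ≤ m i)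
        (U : Bond d (towerP L m (n + 1)) → 𝔸ˣ) (αU : ℕ → ℝ) (_hα0 : ∀ j, 0 ≤ αU j) (hα1 : ∀ j, αU j ≤ 1 / 64)
        (hαL : ∀ j, 50 * (d + 1) * αU j * (L : ℝ) ^ d ≤ 1 / 2)
        (hU1 : ∀ (j : ℕ) (x : B7Prop1Explicit.Site d) (k : Fin d), perCfg (towerP L m (j + 1)) (UlevOf L m (n + 1) U j) x k ∈ U1 𝔸)
        (hreg : ∀ (j : ℕ) (y : TSite d (towerP L m j)) (k : Fin d) (ρ' : Fin d → Fin L),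
          ‖((Wcx L (perCfg (towerP L m (j + 1)) (UlevOf L m (n + 1) U j)) (cornerSite L y) k (boxVec L ρ') : 𝔸ˣ) : 𝔸) - 1‖ ≤ αU j)
        (εU : ℕ → ℝ) (_hεU : ∀ j, 0 ≤ εU j) (_hUε : ∀ (j : ℕ) (b : Bond d (towerP L m (j + 1))), ‖(UlevOf L m (n + 1) U j b : 𝔸) - 1‖ ≤ εU j)
        (_hLb : ∀ (j : ℕ) (b : Bond d (towerP L m (j + 1))), UlevOf L m (n + 1) U j b ∈ U1 𝔸)
        (α : ℝ) (_hα : 0 ≤ α) (_hαle : α ≤ α₁)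
        (hUst : ∀ b, star (U b : 𝔸) = (((U b)⁻¹ : 𝔸ˣ) : 𝔸)) (_hUb : ∀ b, U b ∈ U1 𝔸) (_hUη : ∀ b, ‖(U b : 𝔸) - 1‖ ≤ α * η)
        (_hpl : ∀ p : B9SectCLatticeCarrier.Plaq d (towerP L m (n + 1)), ‖(plaqHolU U p : 𝔸) - 1‖ ≤ α * η ^ 2)
        (_hUgrad : ∀ (x : TSite d (towerP L m (n + 1))) (μ : Fin d), ‖(U (x, μ) : 𝔸) - U (unshift μ x, μ)‖ ≤ α * η ^ 2)
        (_hRlev : ∀ (j : ℕ) (b : Bond d (towerP L m (j + 1))) (w : W), ‖adTransportW φ (UlevOf L m (n + 1) U j) b w‖ ≤ ‖w‖)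
        (_hεg : ∀ j < n + 1, εU j ≤ α * ϱ ^ j) (_hAQ : ∑ j ∈ Finset.range (n + 1), αU j ≤ AQ)
        (hpos' : ∀ x : SiteL2K ℂ d (towerP L m (n + 1)) c₀ W, x ≠ 0 → 0 < RCLike.re ⟪x, laplacePrimeAk L m n φ η U a' (c₁ := c₁) x⟫_ℂ)
        (hpos : ∀ x : BondL2K ℂ d (towerP L m (n + 1)) c₀ W, x ≠ 0 →
          0 < RCLike.re ⟪x, laplaceAk L m n φ η U hL αU hα1 hU1 hreg τ (c₀ := c₀) (c₁ := c₁) a x⟫_ℂ)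
        (_hc₀η : c₀ = η ^ d) (j₀ : ℝ) (_hJ : ∀ μ y, ‖B9Eq39Adjoint.J (fun μ => B9Eq33CovDerivVector.shiftEquiv μ) (fun μ y => U (y, μ)) η μ y‖ ≤ j₀) (_hj : j₀ ≤ j₁)
        (hposπ : ∀ x : BondL2K ℂ d (towerP L m (n + 1)) c₀ W, x ≠ 0 →
          0 < RCLike.re ⟪x, laplaceAkPi L m n φ τ η U a' hpos' hL αU hα1 hU1 hreg (c₁ := c₁) a x⟫_ℂ)
        (hQ : Function.Surjective (QkW L m n φ U hL αU hα1 hU1 hreg (c₀ := c₀) (c₁ := c₁)))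
        (Lw ηw : ℝ) [Fact (0 < Lw)] [Fact (0 < ηw)] (lev₀ : Bond d (towerP L m (n + 1)) → ℕ) (lev₁ : Bond d (towerP L m (n + 1)) × Fin d → ℕ),
        ‖toCLM115 (L := Lw) (η := ηw) (lev₀ := lev₀) lev₁ (covGrad ((η : ℂ))⁻¹ (adTransportW φ U))
            ((WL2.linearEquiv ℂ ℂ (fun _ : Bond d (towerP L m (n + 1)) => c₀)).toLinearMap ∘ₗ (frakGLatticeK hposπ hQ : _ →ₗ[ℂ] _) ∘ₗ
              ((WL2.linearEquiv ℂ ℂ (fun _ : Bond d (towerP L m (n + 1)) => c₀)).symm.toLinearMap :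
                (Bond d (towerP L m (n + 1)) → W) →ₗ[ℂ] BondL2K ℂ d (towerP L m (n + 1)) c₀ W))‖ ≤
          max ((NegSup.wSup (levWeight Lw ηw lev₀ 1) : ℝ) * B) (NegSup.wSup (levWeight Lw ηw lev₁ 2) * B) *
            NegSup.wInvSup (levWeight Lw ηw lev₀ 3) := by
  classical
  obtain ⟨α₁, j₁, B, hα₁, hj₁, hB, HG⟩ := exists_global_supGrad_frakGLatticeKPi_of_thirdWord hd L hL hL3 φ hMφ hMφ' hφ hφ' hstar ha ha' hϱ0 hϱ1 τ hτ hCτ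
    hτm hMτ hρw hτ₁ hτ₂ hφτ AQ H3
  refine ⟨α₁, j₁, B, hα₁, hj₁, hB, ?_⟩
  intro n η hηL c₀ c₁ _ _ hw hρ m _ hm U αU hα0 hα1 hαL hU1 hreg εU hεU hUε hLb α hα hαle hUst hUb hUη hpl hUgrad hRlev hεg hAQ hpos' hpos hc₀η j₀ hJ hj
    hposπ hQ Lw ηw _ _ lev₀ lev₁
  have Hk := HG n η hηL c₀ c₁ hw hρ m hm U αU hα0 hα1 hαL hU1 hreg εU hεU hUε hLb α hα hαle hUst hUb hUη hpl hUgrad hRlev hεg hAQ hpos' hpos hc₀η j₀ hJ hj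
    hposπ hQ
  -- the transformation read on plain bond functions
  have hT : ∀ (g : Bond d (towerP L m (n + 1)) → W) (x : Bond d (towerP L m (n + 1))),
      ((WL2.linearEquiv ℂ ℂ (fun _ : Bond d (towerP L m (n + 1)) => c₀)).toLinearMap ∘ₗ (frakGLatticeK hposπ hQ : _ →ₗ[ℂ] _) ∘ₗ
              ((WL2.linearEquiv ℂ ℂ (fun _ : Bond d (towerP L m (n + 1)) => c₀)).symm.toLinearMap :
                (Bond d (towerP L m (n + 1)) → W) →ₗ[ℂ] BondL2K ℂ d (towerP L m (n + 1)) c₀ W)) g x =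
        WL2.equiv ℂ (fun _ : Bond d (towerP L m (n + 1)) => c₀) W (frakGLatticeK hposπ hQ ((WL2.equiv ℂ (fun _ : Bond d (towerP L m (n + 1)) => c₀) W).symm g)) x := fun _ _ => rfl
  have hgM : ∀ (g : Bond d (towerP L m (n + 1)) → W) (bb : Bond d (towerP L m (n + 1))), ‖WL2.equiv ℂ (fun _ : Bond d (towerP L m (n + 1)) => c₀) W ((WL2.equiv ℂ (fun _ : Bond d (towerP L m (n + 1)) => c₀) W).symm g) bb‖ ≤ ‖g‖ := fun g bb => by
    rw [Equiv.apply_symm_apply]; exact norm_le_pi_norm g bb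
  refine norm_toCLM115_le_of_comp lev₁ _ _ hB hB (fun g => ?_) (fun g => ?_)
  · refine (pi_norm_le_iff_of_nonneg (mul_nonneg hB (norm_nonneg g))).2 fun x => ?_
    rw [hT]
    exact (Hk ((WL2.equiv ℂ (fun _ : Bond d (towerP L m (n + 1)) => c₀) W).symm g) ‖g‖ (norm_nonneg g) (hgM g) ⟨0, hd⟩ x).1
  · refine (pi_norm_le_iff_of_nonneg (mul_nonneg hB (norm_nonneg g))).2 fun bμ => ?_
    obtain ⟨bb, μ⟩ := bμ
    have e : (((WL2.linearEquiv ℂ ℂ (fun _ : Bond d (towerP L m (n + 1)) => c₀)).toLinearMap ∘ₗ (frakGLatticeK hposπ hQ : _ →ₗ[ℂ] _) ∘ₗ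
              ((WL2.linearEquiv ℂ ℂ (fun _ : Bond d (towerP L m (n + 1)) => c₀)).symm.toLinearMap :
                (Bond d (towerP L m (n + 1)) → W) →ₗ[ℂ] BondL2K ℂ d (towerP L m (n + 1)) c₀ W)) g : Bond d (towerP L m (n + 1)) → W) = WL2.equiv ℂ (fun _ : Bond d (towerP L m (n + 1)) => c₀) W (frakGLatticeK hposπ hQ ((WL2.equiv ℂ (fun _ : Bond d (towerP L m (n + 1)) => c₀) W).symm g)) := funext (hT g)
    rw [e]
    exact (Hk ((WL2.equiv ℂ (fun _ : Bond d (towerP L m (n + 1)) => c₀) W).symm g) ‖g‖ (norm_nonneg g) (hgM g) μ bb).2.2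

end Literature.MathematicalPhysics.QuantumFieldTheory.Balaban1983to89.B11Eq117FrakGkPiTransformationNorm

end
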